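import Literature.MathematicalPhysics.QuantumFieldTheory.Balaban1983to89.B6CubeMoutV1L0
import Literature.MathematicalPhysics.QuantumFieldTheory.Balaban1983to89.B6OpTransposeV1
import Literature.MathematicalPhysics.QuantumFieldTheory.Balaban1983to89.B6Cover236MultiLevelBlocksL0
import Literature.MathematicalPhysics.QuantumFieldTheory.Balaban1983to89.B6CubeWindowV1L0
import Literature.MathematicalPhysics.QuantumFieldTheory.Balaban1983to89.B6Eq292MemberTorusV1L0
import Literature.MathematicalPhysics.QuantumFieldTheory.Balaban1983to89.B6Geom246MultiLevelTorusL0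
import Literature.MathematicalPhysics.QuantumFieldTheory.Balaban1983to89.B6GlobalChartV1L0
import Literature.MathematicalPhysics.QuantumFieldTheory.Balaban1983to89.B6MultiLevelTorusOperatorL0
import Literature.MathematicalPhysics.QuantumFieldTheory.Balaban1983to89.B6Prop26KLevelSkeletonV1L0
import Literature.MathematicalPhysics.QuantumFieldTheory.Balaban1983to89.B6Prop26KLevelSkeletonV2L0
/-!
# `Balaban1983to89.B6OpTransposeV1L0` — LEVEL-0 TWIN (programme G-F3′-L0, director-ym LINE №27 / UV3-NODE §24.5; plan `lit-balaban-r03/G-F3L0-PLAN.md`) of `B6OpTransposeV1`: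
the same declarations, SAME NAMES AND STATEMENTS, for nested families WITH print's region `Λ₀ = T ∖ Ω₁` ADMITTED (structures
`B6MultiLevelBoxOperatorL0.Domains` / `B6MultiLevelTorusOperatorL0.TDomains`: levels `0, …, k`, the level-`0` block a single site, `Q′₀ = id`,
finite weight `a₀` — print p.225 (2.14) «Σ_{j=0}^k … (Q′₀λ)(x) = λ(x), x ∈ Λ₀», p.229 «taking a sequence (2.1) … smallest possible domains B^j(Λ_j),
and considering the operator Δ_a defined by (2.19), (2.20) for this sequence»).  Every `D`-free object is the lineage's, consumed BY NAME; no existing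
module is touched; no fact is minted.  Unit `lit-balaban-p33` (p33 gen 101; programme RIGHT-ENTRY-L0 = the (2.136)₃ right-factor chain at level 0, the input of [B9] Thm 3.3's right entry (3.42)₃ for the bond-sector cube letter G_□(1), cell GAPS G-B9-02; port tooling by r03 gen 36–37); B6 fold owner r03; referee ref-4.  THE TWIN'S DOCUMENTATION FOLLOWS
VERBATIM (its «levels 1 … k» / «Ω₁ = X» sentences describe the twin; here `j` runs from `0` and `Ω₁` may be a proper subset).

# `Balaban1983to89.B6OpTransposeV1` — T. Bałaban, *Propagators and renormalization transformations for lattice gauge theories. II*,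
# Commun. Math. Phys. **96** (1984) 223–250 [Balaban1984PropagatorsII], Prop. 2.6 (2.136) p. 247, the RIGHT-factor entry `|(G∇*J)(x)|`:
# THE TRANSPOSE CALCULUS that turns the cube identities of the left walk (2.91)/(2.141) (p38 gen 28–29: `hagree_cube`, `hinvl_cube`, `hdec_cube`,
# `outLoc_Ml_hB`) into the identities of the transposed walk `G₀Δ_a = I − R̃` (`…B6Eq291Transpose`) — every operator of the construction
# (`Δ_a`, `G`, `G_□`, `M_□`, `P_□`, the averaging part, the bond differences) is symmetric or has a named transpose

statement-level skeleton of published theorems with citation tags; proofs where landed; nothing here is a claim about the Yang–Mills mass gap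

PDF held: `paper:balaban1984-cmp96-propagators-rt-ii` (journal page = PDF page + 222); p. 225 [PDF 3] ((2.14): «the operator Q′*aQ′ is given by the
quadratic form ⟨λ, Q′*aQ′λ⟩ = Σ_{j=0}^k Σ_{y∈Λ_j} a_j(Lʲη)^{d−2}|(Q′_jλ)(y)|²» — print's star convention), p. 226 [PDF 4] ((2.19) `Δ_a = ∂*∂ + ∂R∂* + Q*aQ`, «The
operator Q*aQ is defined by a formula similar to (2.14)», (2.22) `G = Δ_a⁻¹`), p. 239 [PDF 17] ((2.90)–(2.93)), p. 247 [PDF 25] ((2.136), (2.141)) re-read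
this generation on the ×2 renders `b2b-balaban-ref1/pages/1984-cmp96-propagators-rt-II/…-p003/p004/p017/p025-x2.png`.
v1.1 (doc-only, Lean byte-identical below the header; referee ref-4 D-g76-3): v1.0 quoted *"Of course Q′* is the adjoint operator"* as print p. 226 — that
sentence is NOT in print (cmp96 pp. 224–226 contain no «adjoint»); print's support for «Q*, ∂* are the adjoints» is the star convention of (2.14) p. 225 and
(2.19)–(2.21) p. 226, now cited instead (three places).

CITATION HEADER (lean-in-tree rule) — WHAT IS REPRODUCED.  Phase-2 file of the `lit-balaban` typed skeleton (HOME `run/shared/lean/pub/lit-balaban/`), seat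
**p38 gen 31**, brick 5 of the programme «(2.136)₃ by the transposed walk» (bricks 1–4: `…B6Prop26RightChainGeneric`, `…B6Eq291Transpose`,
`…B6Ineq2134TransposeDiag`, `…B6Ineq2134TransposeKLevelTorus`); SKELETON rows B6.Eq2.91 × B6.Eq2.92 × B6.Eq2.19–2.22 × B6.Prop2.6 (cells only; decls of
record untouched).  Print's operators are symmetric: `Δ_a = ∂*∂ + ∂R∂* + Q*aQ` with `∂*`, `Q*` the adjoints (star convention, (2.14) p. 225, (2.19) p. 226)
and `R` an orthogonal projection ((2.17), (2.26)), `G = Δ_a⁻¹` (2.22), the `T_□`-operators `Δ_□ + Q*a_□Q`, `∂P_□∂*`, `G_□` likewise (2.90); hence the transposed resolvent identity and the transposed cube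
identities hold.  THIS FILE makes that precise in the tree's language of operators of bond FUNCTIONS (`Module.End ℝ (X → ℝ)`, `X` finite):
* §1 **`tr`** — the transpose (`Matrix.toLin' (LinearMap.toMatrix' T)ᵀ`), characterised by **`dot_tr`** `⟨tr T f, g⟩ = ⟨f, T g⟩` (`Matrix.dotProduct`) and
  **`tr_unique`**; `tr_mul` (order reversed), `tr_add/sub/neg/smul/sum/one/zero`, `tr_tr`, **`tr_mulOp`** (multiplications are symmetric),
  **`inLoc_tr_of_outLoc`** / `outLoc_tr_of_inLoc` (input and output localisation are exchanged), **`tr_transplant`** (`tr (εX′ρ) = ε(tr X′)ρ` for ANY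
  window and chart: `ρ` and `ε` are mutual transposes);
* §2 `ℓ²`: **`dot_onFun`** (`⟨f, onFun T g⟩ = ⟪f, Tg⟫_{ℓ²}`), **`tr_onFun`** (`tr (onFun T) = onFun T†`, Mathlib's `LinearMap.adjoint`), `tr_onFun_of_symm`;
* §3 the torus translations: **`tr_TB`** (`tr τ_a = τ_{−a}`), `tr_conj`;
* §4 THE CUBE: `tr_GlC/MlC/PlC`, **`tr_Gl`**, **`tr_Ml`**, **`tr_Pl`**, **`tr_NC`** (all symmetric: p22's `G_symm`, `deltaA`-type symmetry of `Δ_□ + Q*a_□Q` and of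
  `∂P_□∂*` from `IsLattice.grad_adj`, `a_symm`, the orthogonal projection `R`), **`tr_EC`** (`tr E_{(λ,±)} = E_{(λ,∓)}`: `∇_λ† = ∇_λ*`, p02's `adjoint_Dop`),
  `tr_onFun_localPart` (the global `∂*∂ + ∂∂* + Q*aQ`), `tr_onFun_Dg` (`∂(1 − R)∂*`);
* §5 THE TRANSPOSED CUBE IDENTITIES: **`hagreeT_cube`** (`h_□·M = h_□·M_□`), **`hinvT_cube`** (`h_□G_□(M_□ − P_□) = h_□`), **`hdecT_cube`**
  (`M_□h_□ − h_□M_□ = (Σ_e E_ē·c_e − c₀) + Σ_k (h_□N − Nh_□)·z` — p38 gen 29's `hdec_cube` transposed, `ē = (λ, ∓)`), **`inLoc_hB_Ml`** (`InLoc (h_□M_□) □̃` from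
  p38's `outLoc_Ml_hB`), `onFun_deltaAE_mul_GE` (`Δ_aG = 1`, the left inverse the transposed walk starts from).
DEFINITION (`tr`) + THEOREMS, all proved, 0 sorry, no `def … : Prop`; standard axioms.

HONEST SCOPE / DIVERGENCES.  (1) `tr` is the transpose for the DOT product of bond functions (lattice units; print's `ℓ²` pairing (2.69) up to the uniform
factor `η^d`), which is what the block-majorant bookkeeping needs; no weighted adjoint is introduced.  (2) Nothing analytic: this file moves identities, not
estimates (block majorants do NOT transpose — the reason for the whole programme, see `…B6Prop26RightChainGeneric`).  (3) The symmetry of the two-scale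
`G_□` uses the member's lattice/positivity structure (`B6SectCTwoScaleV1Lattice.isLattice/positive`, `a₀ > 0`).  Nothing on d = 4 or the continuum; NOT
summit progress.  Unit `lit-balaban-p38` (gen 31), 2026-08-23.
-/

noncomputable section

open scoped BigOperators InnerProductSpace
open Finset Matrix

namespace Literature.MathematicalPhysics.QuantumFieldTheory.Balaban1983to89.B6OpTransposeV1L0

open B6Prop26Gluing (mulOp mulOp_apply OutLoc InLoc)
open B6RandomWalk (BlockSupp)
open B6Prop26ReachTransplant (transplant restrictOp extendOp restrictOp_apply extendOp_apply)
open B6Ineq2133TwoScaleV1 (onFun onFun_apply)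

-- (§1–§3 of the original — `tr` and its generic ∕ transplant ∕ ℓ² ∕ translation calculus — are `D`-free and opened BY NAME below)
open B6OpTransposeV1 (tr tr_mul tr_add tr_sub tr_smul tr_sum tr_mulOp tr_transplant tr_conj inLoc_tr_of_outLoc tr_onFun_G tr_onFun_M tr_onFun_P
  tr_onFun_QaQ tr_onFun_Dl tr_onFun_localPart)

/-! ## §4  The cube: every operator of the construction is symmetric or has a named transpose -/

section Cube

open B6GlobalChartV1 (PV)
open B6GlobalChartV1L0 (domT blkV1)
open B6SectAOperatorsV1 (dE dsE dcE dcsE QE aE QsE RE BondIdx inner_dE_left inner_dsE_left inner_dcsE_left inner_QsE_left inner_aE_left inner_RE_left)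
open B6SectAVectorModelV1 (deltaAE GE deltaAE_comp_GE)
open B6Prop25TwoScaleCensus (TSIdx)
open B6AgreeLapV1Chart (cB eB posV transplant_eB_eq onFun_comp onFun_id onFun_add)
open B6MultiLevelBoxOperator (N0)
open B6MultiLevelTorusOperatorL0 (TDomains)
open B6Cover236MultiLevelBlocksL0 (cubes)
open B6Eq238MultiLevelTorus (svec)
open B6Geom246MultiLevelTorusL0 (geomT)
open B6TranslateV1 (trV)
open B6TranslateTorusV1 (vch TB TB_mul_TB_neg TB_neg_mul_TB)
open B6Prop26KLevelSkeletonV1L0 (hB ST)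
open B6Prop26KLevelSkeletonV2L0 (SbigT)
open B6CubeWindowV1 (x0 Placed eC)
open B6CubeWindowV1L0 (tC sc hx0 hfit wC hch Gl Ml Pl GlC MlC PlC j0 j0_hj hagree_cube hinvl_cube)
open B6AgreeQaQV1Chart (NearB)
open B6MemberOfCubeV1 (bare)
open B6Eq292MemberTorusV1L0 (EC NC zC cfC c0C hdec_cube)
open B6CubeMoutV1L0 (outLoc_Ml_hB)
open B6SectCTwoScaleV1Lattice (isLattice positive)
open B6SectCPositivity (G_symm)
open B6SectCOperators.TwoScaleData (lapV_symm)
open B6Eq2112Assembly (starProjection_symm_form)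
open B6BlockDecayGDivBridgeV1 (adjoint_Dop)

variable {d ℓ : ℕ} {hd : 1 ≤ d + 1} {hL : Odd (ℓ + 1) ∧ 1 < ℓ + 1} {a₀ a₁ : ℝ} {m K : ℕ} {Mh k R : ℕ} {P' : Fin (d + 1) → ℕ}
variable (hN : ∀ μ, N0 ℓ Mh k P' μ = (PV d ℓ m K hd hL).sitesPerDir 0) {D : TDomains d ℓ Mh k P' R} (hk : k ≤ m + K)
  (hMh1 : 1 ≤ Mh) (hP4 : ∀ μ, 4 ≤ P' μ) {a : ℕ} (hMha : Mh = (ℓ + 1) ^ a) (c : ↥(cubes D.toDomains)) (ha : a₀ ≤ a₁)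

/-- `tr G_□^{ch} = G_□^{ch}` (chart frame). [cite: Balaban1984PropagatorsII, (2.90)–(2.91) p.239] -/
theorem tr_GlC (ha₀ : 0 < a₀) (hpl : Placed ℓ k P' c.1) (w : BondIdx (B6GlobalChartV1L0.domT hN D hk) → ℝ) (cf : ℝ) :
    tr (GlC hN hk hMh1 hP4 hMha c ha hpl (wC hN hk c w) cf) = GlC hN hk hMh1 hP4 hMha c ha hpl (wC hN hk c w) cf := by
  unfold GlC B6GlobalChartV1.GlV1
  rw [tr_smul, tr_transplant, tr_onFun_G ha₀]

/-- `tr M_□^{ch} = M_□^{ch}`. [cite: Balaban1984PropagatorsII, (2.90)–(2.91) p.239] -/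
theorem tr_MlC (ha₀ : 0 < a₀) (hpl : Placed ℓ k P' c.1) (w : BondIdx (B6GlobalChartV1L0.domT hN D hk) → ℝ) (cf : ℝ) :
    tr (MlC hN hk hMh1 hP4 hMha c ha hpl (wC hN hk c w) cf) = MlC hN hk hMh1 hP4 hMha c ha hpl (wC hN hk c w) cf := by
  unfold MlC
  rw [tr_smul, tr_transplant, tr_onFun_M ha₀]

/-- `tr P_□^{ch} = P_□^{ch}`. [cite: Balaban1984PropagatorsII, (2.90)–(2.91) p.239] -/
theorem tr_PlC (ha₀ : 0 < a₀) (hpl : Placed ℓ k P' c.1) (w : BondIdx (B6GlobalChartV1L0.domT hN D hk) → ℝ) (cf : ℝ) :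
    tr (PlC hN hk hMh1 hP4 hMha c ha hpl (wC hN hk c w) cf) = PlC hN hk hMh1 hP4 hMha c ha hpl (wC hN hk c w) cf := by
  unfold PlC
  rw [tr_smul, tr_transplant, tr_onFun_P ha₀]

/-- **`tr G_□ = G_□`** on the global torus. [cite: Balaban1984PropagatorsII, (2.90)–(2.91) p.239, (2.22) p.226] -/
theorem tr_Gl (ha₀ : 0 < a₀) (hpl : Placed ℓ k P' c.1) (w : BondIdx (B6GlobalChartV1L0.domT hN D hk) → ℝ) (cf : ℝ) :
    tr (Gl hN hk hMh1 hP4 hMha c ha hpl w cf) = Gl hN hk hMh1 hP4 hMha c ha hpl w cf := by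
  unfold Gl; rw [tr_conj, tr_GlC hN hk hMh1 hP4 hMha c ha ha₀]

/-- **`tr M_□ = M_□`**. [cite: Balaban1984PropagatorsII, (2.90)–(2.91) p.239, (2.19) p.226] -/
theorem tr_Ml (ha₀ : 0 < a₀) (hpl : Placed ℓ k P' c.1) (w : BondIdx (B6GlobalChartV1L0.domT hN D hk) → ℝ) (cf : ℝ) :
    tr (Ml hN hk hMh1 hP4 hMha c ha hpl w cf) = Ml hN hk hMh1 hP4 hMha c ha hpl w cf := by
  unfold Ml; rw [tr_conj, tr_MlC hN hk hMh1 hP4 hMha c ha ha₀]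

/-- **`tr P_□ = P_□`**. [cite: Balaban1984PropagatorsII, (2.90)–(2.91) p.239, (2.10) p.225] -/
theorem tr_Pl (ha₀ : 0 < a₀) (hpl : Placed ℓ k P' c.1) (w : BondIdx (B6GlobalChartV1L0.domT hN D hk) → ℝ) (cf : ℝ) :
    tr (Pl hN hk hMh1 hP4 hMha c ha hpl w cf) = Pl hN hk hMh1 hP4 hMha c ha hpl w cf := by
  unfold Pl; rw [tr_conj, tr_PlC hN hk hMh1 hP4 hMha c ha ha₀]

/-- **`tr N = N`** for the averaging partner `N = τ(s•ε(Q*a_□Q)ρ)τ`. [cite: Balaban1984PropagatorsII, (2.92) p.239 (line 2), (2.18) p.226] -/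
theorem tr_NC (ha₀ : 0 < a₀) (hpl : Placed ℓ k P' c.1) (w : BondIdx (B6GlobalChartV1L0.domT hN D hk) → ℝ) (cf : ℝ) :
    tr (NC hN hk hMh1 hP4 hMha c ha hpl w cf) = NC hN hk hMh1 hP4 hMha c ha hpl w cf := by
  unfold NC
  rw [tr_conj, tr_smul, tr_transplant, tr_onFun_QaQ ha₀]

/-- **`tr E_{(λ,±)} = E_{(λ,∓)}`**: the transposes of the cube's first-order operators are the cube's first-order operators of the opposite orientation.
[cite: Balaban1984PropagatorsII, (2.92) p.239 (line 1); Balaban1984PropagatorsI, (1.89) p.33] -/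
theorem tr_EC (hpl : Placed ℓ k P' c.1) (w : BondIdx (B6GlobalChartV1L0.domT hN D hk) → ℝ) (cf : ℝ) (e : Fin (d + 1) × Bool) :
    tr (EC hN hk hMh1 hP4 hMha c ha hpl w cf e) = EC hN hk hMh1 hP4 hMha c ha hpl w cf (e.1, !e.2) := by
  unfold EC
  rw [tr_conj, tr_transplant, tr_onFun_Dl]

/-! ## §5  The transposed cube identities -/

/-- **(hagreeT) FOR THE CUBE: `h_□·M = h_□·M_□`** — p38's `hagree_cube` transposed (`M`, `M_□` symmetric, `h_□·` symmetric).
[cite: Balaban1984PropagatorsII, (2.89)–(2.91) p.239, (2.19) p.226] -/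
theorem hagreeT_cube (ha₀ : 0 < a₀) (hk2 : 2 ≤ k) (hM8 : 8 ≤ Mh) (hR2 : 2 * (ℓ + 1) ^ 2 ≤ R) (hpl : Placed ℓ k P' c.1)
    (w : BondIdx (B6GlobalChartV1L0.domT hN D hk) → ℝ) {cf : ℝ} (hcf : cf ≠ 0)
    (hband : ∀ i : BondIdx (domT hN (D.chart (svec ℓ k c.1.1 c.1.2)) hk), ((i.1.1 : ℕ) = j0 hMh1 hP4 c ∨ (i.1.1 : ℕ) = j0 hMh1 hP4 c + 1) →
      NearB (bare d ℓ hd hL (eC a c.1.1) 0 (j0 hMh1 hP4 c) (j0_hj hMh1 hP4 c a) ha) (x0 ℓ Mh k c.1) (4 * (ℓ + 1) ^ (j0 hMh1 hP4 c + 1)) i.1.1 i.1.2 →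
      a₀ * ((((ℓ + 1 : ℕ) : ℝ)) ^ j0 hMh1 hP4 c) ^ (d + 1) ≤ wC hN hk c w i / (cf / (((ℓ + 1 : ℕ) : ℝ) ^ j0 hMh1 hP4 c)) ^ 2 ∧
        wC hN hk c w i / (cf / (((ℓ + 1 : ℕ) : ℝ) ^ j0 hMh1 hP4 c)) ^ 2 ≤ a₁ * ((((ℓ + 1 : ℕ) : ℝ)) ^ j0 hMh1 hP4 c) ^ (d + 1)) :
    mulOp (hB hN D c) * onFun (dcsE (P := PV d ℓ m K hd hL) cf ∘ₗ dcE cf + dE cf ∘ₗ dsE cf +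
        QsE (domT hN D hk) ∘ₗ aE (domT hN D hk) w ∘ₗ QE (domT hN D hk)) =
      mulOp (hB hN D c) * Ml hN hk hMh1 hP4 hMha c ha hpl w cf := by
  have h := congrArg tr (hagree_cube hN hk hMh1 hP4 hMha c ha hk2 hM8 hR2 hpl w hcf hband)
  rw [tr_mul, tr_mul, tr_mulOp, tr_onFun_localPart, tr_Ml hN hk hMh1 hP4 hMha c ha ha₀] at h
  exact h

/-- **(hinvT) FOR THE CUBE: `h_□G_□(M_□ − P_□) = h_□`** — p38's `hinvl_cube` transposed. [cite: Balaban1984PropagatorsII, (2.90)–(2.91), (2.94) p.239] -/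
theorem hinvT_cube (ha₀ : 0 < a₀) (hM8 : 8 ≤ Mh) (hR2 : 2 * (ℓ + 1) ^ 2 ≤ R) (hpl : Placed ℓ k P' c.1)
    (w : BondIdx (B6GlobalChartV1L0.domT hN D hk) → ℝ) {cf : ℝ} (hcf : cf ≠ 0) :
    mulOp (hB hN D c) * Gl hN hk hMh1 hP4 hMha c ha hpl w cf * (Ml hN hk hMh1 hP4 hMha c ha hpl w cf - Pl hN hk hMh1 hP4 hMha c ha hpl w cf) =
      mulOp (hB hN D c) := by
  have h := congrArg tr (hinvl_cube hN hk hMh1 hP4 hMha c ha ha₀ hM8 hR2 hpl w hcf)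
  rw [tr_mul, tr_mul, tr_mulOp, tr_sub, tr_Gl hN hk hMh1 hP4 hMha c ha ha₀, tr_Ml hN hk hMh1 hP4 hMha c ha ha₀,
    tr_Pl hN hk hMh1 hP4 hMha c ha ha₀, ← mul_assoc] at h
  exact h

/-- **(hdecT) FOR THE CUBE: `M_□h_□ − h_□M_□ = (Σ_e E_ē·c_e − c₀) + Σ_k (h_□N − Nh_□)·z`** (`ē = (λ, ∓)`) — p38 gen 29's `hdec_cube` transposed: the INPUT-side
decomposition of the reversed commutator consumed by `…B6Ineq2134TransposeKLevelTorus.ineq2134T_kDiag_torus`.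
[cite: Balaban1984PropagatorsII, (2.92) p.239 (lines 1–2), (2.90)–(2.91), (2.94) p.239] -/
theorem hdecT_cube (ha₀ : 0 < a₀) (hM8 : 8 ≤ Mh) (hR2 : 2 * (ℓ + 1) ^ 2 ≤ R) (hpl : Placed ℓ k P' c.1) (w : BondIdx (B6GlobalChartV1L0.domT hN D hk) → ℝ) (cf : ℝ) :
    Ml hN hk hMh1 hP4 hMha c ha hpl w cf * mulOp (hB hN D c) - mulOp (hB hN D c) * Ml hN hk hMh1 hP4 hMha c ha hpl w cf =
      (∑ e ∈ (Finset.univ : Finset (Fin (d + 1) × Bool)),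
          EC hN hk hMh1 hP4 hMha c ha hpl w cf (e.1, !e.2) * mulOp (cfC hN hk hMh1 hP4 hMha c ha hpl w cf e) -
        mulOp (c0C hN hk hMh1 hP4 hMha c ha hpl w cf)) +
      ∑ _k ∈ ({()} : Finset Unit), (mulOp (hB hN D c) * NC hN hk hMh1 hP4 hMha c ha hpl w cf -
        NC hN hk hMh1 hP4 hMha c ha hpl w cf * mulOp (hB hN D c)) * mulOp (zC hN hk hMh1 hP4 hMha c ha hpl w cf) := by
  have h := congrArg tr (hdec_cube hN hk hMh1 hP4 hMha c ha hM8 hR2 hpl w cf)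
  rw [tr_sub, tr_mul, tr_mul, tr_mulOp, tr_Ml hN hk hMh1 hP4 hMha c ha ha₀, tr_add, tr_sub, tr_sum, tr_sum, tr_mulOp] at h
  simp only [tr_mul, tr_mulOp, tr_sub, tr_EC, tr_NC hN hk hMh1 hP4 hMha c ha ha₀] at h
  exact h

/-- **INPUT LOCALISATION OF `h_□M_□` OVER `□̃`** — p38's `outLoc_Ml_hB` transposed (the hypothesis `hMin` of `ineq2134T_kDiag_torus`).
[cite: Balaban1984PropagatorsII, (2.91)–(2.92) p.239 (range of Δ, supp h_□ ⊂ □̃)] -/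
theorem inLoc_hB_Ml (ha₀ : 0 < a₀) (hM8 : 8 ≤ Mh) (hR2 : 2 * (ℓ + 1) ^ 2 ≤ R) (hP5 : ∀ μ, 5 ≤ P' μ) (hpl : Placed ℓ k P' c.1)
    (w : BondIdx (B6GlobalChartV1L0.domT hN D hk) → ℝ) (cf : ℝ)
    (hcfT : ∀ (e : Fin (d + 1) × Bool) (x : PBond (PV d ℓ m K hd hL) 0),
      cfC hN hk hMh1 hP4 hMha c ha hpl w cf e x ≠ 0 → blkV1 hN D x ∈ ST D hMh1 hP4 c)
    (hc0T : ∀ x : PBond (PV d ℓ m K hd hL) 0, c0C hN hk hMh1 hP4 hMha c ha hpl w cf x ≠ 0 → blkV1 hN D x ∈ ST D hMh1 hP4 c) :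
    InLoc (g := geomT D) (blkV1 hN D) (mulOp (hB hN D c) * Ml hN hk hMh1 hP4 hMha c ha hpl w cf) (SbigT D hMh1 hP4 c) := by
  have h := inLoc_tr_of_outLoc (g := geomT D) (blkV1 hN D) (outLoc_Ml_hB hN hk hMh1 hP4 hMha c ha hM8 hR2 hP5 hpl w cf hcfT hc0T)
  rw [tr_mul, tr_mulOp, tr_Ml hN hk hMh1 hP4 hMha c ha ha₀] at h
  exact h

end Cube

end Literature.MathematicalPhysics.QuantumFieldTheory.Balaban1983to89.B6OpTransposeV1L0
end
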